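import Mathlib
import Summits.PneNP.PneNP.Theorems.ConvexRankGatesConvexGateBlindAffinePencilTwoWitness

/-!
# PneNP / ConvexRankGates — `ConvexGateBlind`: a valid `2 × 2` pencil excludes at most three `k`-subsets of any `(k+1)`-set

Helpers (`--supports stmt-PneNP-10680`), COLUMN-SPACE line (prover seat 2, session 26), PSD side; memo
ANALYSIS-seat2-s26 §2.2 / §3.1 (cyclic circle argument). For the dual-affine PSD class of the crux with `2 × 2` matrices,
PSD on every `k`-clique-free graph (`k ≥ 3`): inside every `(k+1)`-set `V` of vertices at most THREE of the `k + 1` bare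
cliques `V − v` are excluded (`two_pencil_superset_excluded_le_three`). For `k = 3`: a valid `2 × 2` pencil never excludes
all four triangles of a `K_4` (`two_pencil_not_four_triangles`), so `c(2; 4, 3) = 3` exactly (three triangles at a vertex
ARE excludable, memo §2.2) and the excluded triangles always form a `K₄⁽³⁾`-free triple system.

Proof: four excluded cliques `V − a, V − b, V − c, V − d` have pairwise distinct half-circle parameters (`twoWit`); sort
them `t_a < t_b < t_c < t_d`. For the edges `e = bd`, `f = ac` the swap lemma (`pairForm_pos/neg_of_excluded`) makes the
pair form `y(t)ᵀ(H_e − H_f)y(t)` positive at `t_a`, negative at `t_b`, positive at `t_c`, negative at `t_d` — three sign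
changes on `(−1, 1]` of an affine function of the doubled point of the circle, which has no three zeros there
(`circleAffine_no_three_zeros`). [new]
-/

set_option linter.dupNamespace false

namespace Summit.PneNP.PneNP.Theorems

open Finset Real Matrix Literature.Computability.Complexity
open Summit.PneNP.PneNP.Cruxes.ConvexGateBlind.StrictRankConicCover (Edge cdist)

noncomputable section

variable {m : ℕ}

/-- **No `+ − + −` alternation.** An affine function of the doubled point `P(t)` cannot be positive, negative, positive,
negative at four increasing parameters of `(−1, 1]`. [folklore] -/
theorem circleAffine_no_alternation_four {α β γ t₁ t₂ t₃ t₄ : ℝ} (h₁₂ : t₁ < t₂) (h₂₃ : t₂ < t₃) (h₃₄ : t₃ < t₄)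
    (hlo : -1 < t₁) (hhi : t₄ ≤ 1)
    (hp₁ : 0 < circleAffine α β γ t₁) (hn₂ : circleAffine α β γ t₂ < 0)
    (hp₃ : 0 < circleAffine α β γ t₃) (hn₄ : circleAffine α β γ t₄ < 0) : False := by
  have hβγ : β ≠ 0 ∨ γ ≠ 0 := by
    by_contra h
    push Not at h
    obtain ⟨rfl, rfl⟩ := h
    simp [circleAffine] at hp₁ hn₂; linarith
  have hneg : ∀ t, circleAffine (-α) (-β) (-γ) t = -circleAffine α β γ t := fun t => by
    simp only [circleAffine]; ring
  obtain ⟨z₁, ⟨hz₁, hz₁'⟩, hq₁⟩ := circleAffine_exists_zero h₁₂ hp₁ hn₂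
  obtain ⟨z₂, ⟨hz₂, hz₂'⟩, hq₂⟩ :=
    circleAffine_exists_zero (α := -α) (β := -β) (γ := -γ) h₂₃ (by rw [hneg]; linarith) (by rw [hneg]; linarith)
  rw [hneg, neg_eq_zero] at hq₂
  obtain ⟨z₃, ⟨hz₃, hz₃'⟩, hq₃⟩ := circleAffine_exists_zero h₃₄ hp₃ hn₄
  exact circleAffine_no_three_zeros hβγ (by linarith) (by linarith) (by linarith) (by linarith) hq₁ hq₂ hq₃

/-- `cliqueVec Q` on the edge `s(a,b)`. [folklore] -/
theorem cliqueVec_mk_eq_true_iff (Q : Finset (Fin m)) {a b : Fin m}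
    (hab : s(a, b) ∈ (⊤ : SimpleGraph (Fin m)).edgeSet) :
    cliqueVec Q ⟨s(a, b), hab⟩ = true ↔ a ∈ Q ∧ b ∈ Q := by
  simp only [cliqueVec, Sym2.mem_iff, forall_eq_or_imp, forall_eq, decide_eq_true_eq]

/-- The sorted core of the argument: four distinct vertices `a, b, c, d` of a `(k+1)`-set `V` whose cliques `V − ·` are
all excluded, with parameters `t_a < t_b < t_c < t_d`, are contradictory. [new] -/
theorem two_pencil_coface_sorted {k : ℕ} (hk : 3 ≤ k) (H₀ : Matrix (Fin 2) (Fin 2) ℝ)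
    (He : Edge m → Matrix (Fin 2) (Fin 2) ℝ)
    (hvalid : ∀ u : Edge m → Bool, cliqueFn m k u = false → (pen2 H₀ He u).PosSemidef)
    {V : Finset (Fin m)} (hV : V.card = k + 1) {a b c d : Fin m} (ha : a ∈ V) (hb : b ∈ V) (hc : c ∈ V) (hd : d ∈ V)
    (hab : a ≠ b) (hac : a ≠ c) (had : a ≠ d) (hbc : b ≠ c) (hbd : b ≠ d) (hcd : c ≠ d)
    (hxa : ¬ (pen2 H₀ He (cliqueVec (V.erase a))).PosSemidef) (hxb : ¬ (pen2 H₀ He (cliqueVec (V.erase b))).PosSemidef)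
    (hxc : ¬ (pen2 H₀ He (cliqueVec (V.erase c))).PosSemidef) (hxd : ¬ (pen2 H₀ He (cliqueVec (V.erase d))).PosSemidef)
    (h₁ : twoWit H₀ He (V.erase a) < twoWit H₀ He (V.erase b))
    (h₂ : twoWit H₀ He (V.erase b) < twoWit H₀ He (V.erase c))
    (h₃ : twoWit H₀ He (V.erase c) < twoWit H₀ He (V.erase d)) : False := by
  have hcard : ∀ v ∈ V, (V.erase v).card = k := fun v hv => by rw [card_erase_of_mem hv, hV]; rfl
  -- the two edges `e = bd`, `f = ac`
  have hebd : s(b, d) ∈ (⊤ : SimpleGraph (Fin m)).edgeSet := by simpa using hbd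
  have hfac : s(a, c) ∈ (⊤ : SimpleGraph (Fin m)).edgeSet := by simpa using hac
  set e : Edge m := ⟨s(b, d), hebd⟩
  set f : Edge m := ⟨s(a, c), hfac⟩
  have memE : ∀ {v x : Fin m}, x ∈ V → (x ∈ V.erase v ↔ x ≠ v) := fun hx => by simp [mem_erase, hx]
  have he_a : cliqueVec (V.erase a) e = true :=
    (cliqueVec_mk_eq_true_iff _ hebd).2 ⟨(memE hb).2 hab.symm, (memE hd).2 had.symm⟩
  have hf_a : cliqueVec (V.erase a) f = false := by
    rw [Bool.eq_false_iff, ne_eq, cliqueVec_mk_eq_true_iff]; exact fun h => ((memE ha).1 h.1) rfl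
  have he_b : cliqueVec (V.erase b) e = false := by
    rw [Bool.eq_false_iff, ne_eq, cliqueVec_mk_eq_true_iff]; exact fun h => ((memE hb).1 h.1) rfl
  have hf_b : cliqueVec (V.erase b) f = true :=
    (cliqueVec_mk_eq_true_iff _ hfac).2 ⟨(memE ha).2 hab, (memE hc).2 hbc.symm⟩
  have he_c : cliqueVec (V.erase c) e = true :=
    (cliqueVec_mk_eq_true_iff _ hebd).2 ⟨(memE hb).2 hbc, (memE hd).2 hcd.symm⟩
  have hf_c : cliqueVec (V.erase c) f = false := by
    rw [Bool.eq_false_iff, ne_eq, cliqueVec_mk_eq_true_iff]; exact fun h => ((memE hc).1 h.2) rfl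
  have he_d : cliqueVec (V.erase d) e = false := by
    rw [Bool.eq_false_iff, ne_eq, cliqueVec_mk_eq_true_iff]; exact fun h => ((memE hd).1 h.2) rfl
  have hf_d : cliqueVec (V.erase d) f = true :=
    (cliqueVec_mk_eq_true_iff _ hfac).2 ⟨(memE ha).2 had, (memE hc).2 hcd⟩
  -- signs of the pair form at the four parameters
  have s₁ := pairForm_pos_of_excluded hk H₀ He hvalid (hcard a ha) hxa he_a hf_a
  have s₂ := pairForm_neg_of_excluded hk H₀ He hvalid (hcard b hb) hxb he_b hf_b
  have s₃ := pairForm_pos_of_excluded hk H₀ He hvalid (hcard c hc) hxc he_c hf_c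
  have s₄ := pairForm_neg_of_excluded hk H₀ He hvalid (hcard d hd) hxd he_d hf_d
  have hlo := (twoWit_spec hk H₀ He hvalid hxa).1.1
  have hhi := (twoWit_spec hk H₀ He hvalid hxd).1.2
  unfold pairForm at s₁ s₂ s₃ s₄
  exact circleAffine_no_alternation_four h₁ h₂ h₃ hlo hhi s₁ s₂ s₃ s₄

open Classical in
/-- **At most three cofaces.** For a `2 × 2` pencil PSD on every `k`-clique-free graph (`k ≥ 3`) and every `(k+1)`-set
`V`, at most three of the bare cliques `V − v`, `v ∈ V`, are excluded. [new] -/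
theorem two_pencil_coface_le_three {k : ℕ} (hk : 3 ≤ k) (H₀ : Matrix (Fin 2) (Fin 2) ℝ)
    (He : Edge m → Matrix (Fin 2) (Fin 2) ℝ)
    (hvalid : ∀ u : Edge m → Bool, cliqueFn m k u = false → (pen2 H₀ He u).PosSemidef)
    {V : Finset (Fin m)} (hV : V.card = k + 1) :
    (V.filter fun v => ¬ (pen2 H₀ He (cliqueVec (V.erase v))).PosSemidef).card ≤ 3 := by
  by_contra hgt
  push Not at hgt
  set X := V.filter fun v => ¬ (pen2 H₀ He (cliqueVec (V.erase v))).PosSemidef with hX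
  -- four excluded cofaces
  obtain ⟨D, hDX, hD⟩ := exists_subset_card_eq (show 4 ≤ X.card by omega)
  have hDV : ∀ {v}, v ∈ D → v ∈ V := fun hv => (mem_filter.1 (hDX hv)).1
  have hDx : ∀ {v}, v ∈ D → ¬ (pen2 H₀ He (cliqueVec (V.erase v))).PosSemidef := fun hv => (mem_filter.1 (hDX hv)).2
  have hcard : ∀ v ∈ V, (V.erase v).card = k := fun v hv => by rw [card_erase_of_mem hv, hV]; rfl
  set t : Fin m → ℝ := fun v => twoWit H₀ He (V.erase v) with ht
  -- distinct excluded vertices have distinct parameters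
  have hne : ∀ {v w : Fin m}, v ∈ D → w ∈ D → v ≠ w → t v ≠ t w := by
    intro v w hv hw hvw h
    have hVe := twoWit_injOn hk H₀ He hvalid (hcard v (hDV hv)) (hcard w (hDV hw)) (hDx hv) (hDx hw) h
    have : w ∈ V.erase v := mem_erase.2 ⟨fun h' => hvw h'.symm, hDV hw⟩
    rw [hVe] at this
    exact (notMem_erase w V) this
  have hDne : D.Nonempty := card_pos.1 (by omega)
  obtain ⟨p, hp, hpmin⟩ := exists_min_image D t hDne
  obtain ⟨s, hs, hsmax⟩ := exists_max_image D t hDne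
  -- `p ≠ s`
  have hps : p ≠ s := by
    intro hps
    obtain ⟨v, hv, hvp⟩ := exists_mem_ne (by omega : 1 < D.card) p
    have h1 := hpmin v hv
    have h2 := hsmax v hv
    rw [← hps] at h2
    exact hne hv hp hvp (le_antisymm h2 h1)
  -- the two middle vertices
  have hsR : s ∈ D.erase p := mem_erase.2 ⟨fun h => hps h.symm, hs⟩
  have hRcard : ((D.erase p).erase s).card = 2 := by
    rw [card_erase_of_mem hsR, card_erase_of_mem hp, hD]
  obtain ⟨r₁, r₂, hr, hR⟩ := card_eq_two.1 hRcard
  have hr₁ : r₁ ∈ (D.erase p).erase s := by rw [hR]; simp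
  have hr₂ : r₂ ∈ (D.erase p).erase s := by rw [hR]; simp
  simp only [mem_erase] at hr₁ hr₂
  obtain ⟨hr₁s, hr₁p, hr₁D⟩ := hr₁
  obtain ⟨hr₂s, hr₂p, hr₂D⟩ := hr₂
  -- strict comparisons with the extremes
  have lt_of_min : ∀ {v : Fin m}, v ∈ D → v ≠ p → t p < t v := fun hv hvp =>
    lt_of_le_of_ne (hpmin _ hv) (hne hp hv hvp.symm)
  have lt_of_max : ∀ {v : Fin m}, v ∈ D → v ≠ s → t v < t s := fun hv hvs =>
    lt_of_le_of_ne (hsmax _ hv) (hne hv hs hvs)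
  rcases lt_or_gt_of_ne (hne hr₁D hr₂D hr) with h12 | h21
  · exact two_pencil_coface_sorted hk H₀ He hvalid hV (hDV hp) (hDV hr₁D) (hDV hr₂D) (hDV hs)
      (fun h => hr₁p h.symm) (fun h => hr₂p h.symm) hps hr hr₁s hr₂s (hDx hp) (hDx hr₁D) (hDx hr₂D) (hDx hs)
      (lt_of_min hr₁D hr₁p) h12 (lt_of_max hr₂D hr₂s)
  · exact two_pencil_coface_sorted hk H₀ He hvalid hV (hDV hp) (hDV hr₂D) (hDV hr₁D) (hDV hs)
      (fun h => hr₂p h.symm) (fun h => hr₁p h.symm) hps hr.symm hr₂s hr₁s (hDx hp) (hDx hr₂D) (hDx hr₁D) (hDx hs)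
      (lt_of_min hr₂D hr₂p) h21 (lt_of_max hr₁D hr₁s)

open Classical in
/-- **A valid `2 × 2` pencil never excludes all four triangles of a `K_4`.** [new] -/
theorem two_pencil_K4 (H₀ : Matrix (Fin 2) (Fin 2) ℝ) (He : Edge m → Matrix (Fin 2) (Fin 2) ℝ)
    (hvalid : ∀ u : Edge m → Bool, cliqueFn m 3 u = false → (pen2 H₀ He u).PosSemidef)
    {V : Finset (Fin m)} (hV : V.card = 4) :
    ∃ v ∈ V, (pen2 H₀ He (cliqueVec (V.erase v))).PosSemidef := by
  have h3 := two_pencil_coface_le_three le_rfl H₀ He hvalid hV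
  by_contra hall
  push Not at hall
  have : (V.filter fun v => ¬ (pen2 H₀ He (cliqueVec (V.erase v))).PosSemidef) = V :=
    filter_true_of_mem fun v hv => hall v hv
  rw [this, hV] at h3
  omega

open Classical in
/-- **Registered form** (`two_pencil_superset_excluded_le_three`): for `2 × 2` matrices `H₀, H_e` with
`H₀ − Σ_{e∈u} H_e ⪰ 0` on every `k`-clique-free graph `u` of `K_m` (`k ≥ 3`), every `(k+1)`-set `V` has at most three
vertices `v` whose bare clique `V − v` is excluded (`H₀ − Σ_{e ⊆ V−v} H_e ⋡ 0`). [new] -/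
theorem two_pencil_superset_excluded_le_three : ∀ {m k : ℕ}, 3 ≤ k → ∀ (H₀ : Matrix (Fin 2) (Fin 2) ℝ) (He : Edge m → Matrix (Fin 2) (Fin 2) ℝ), (∀ u : Edge m → Bool, cliqueFn m k u = false → (H₀ - ∑ e, if u e = true then He e else 0).PosSemidef) → ∀ (V : Finset (Fin m)), V.card = k + 1 → (V.filter fun v => ¬ (H₀ - ∑ e, if cliqueVec (V.erase v) e = true then He e else 0).PosSemidef).card ≤ 3 :=
  fun hk H₀ He hvalid _ hV => two_pencil_coface_le_three hk H₀ He hvalid hV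

/-- **Registered form** (`two_pencil_not_four_triangles`): for `2 × 2` matrices `H₀, H_e` with `H₀ − Σ_{e∈u} H_e ⪰ 0` on
every triangle-free graph `u` of `K_m`, every `4`-set `V` of vertices has a vertex `v` whose triangle `V − v` is NOT
excluded (`H₀ − Σ_{e ⊆ V−v} H_e ⪰ 0`). Hence `c(2; 4, 3) = 3`, and the triangles excluded by a valid `2 × 2` pencil form a
`K₄⁽³⁾`-free family. [new] -/
theorem two_pencil_not_four_triangles : ∀ {m : ℕ} (H₀ : Matrix (Fin 2) (Fin 2) ℝ) (He : Edge m → Matrix (Fin 2) (Fin 2) ℝ), (∀ u : Edge m → Bool, cliqueFn m 3 u = false → (H₀ - ∑ e, if u e = true then He e else 0).PosSemidef) → ∀ (V : Finset (Fin m)), V.card = 4 → ∃ v ∈ V, (H₀ - ∑ e, if cliqueVec (V.erase v) e = true then He e else 0).PosSemidef :=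
  fun H₀ He hvalid _ hV => two_pencil_K4 H₀ He hvalid hV

end

end Summit.PneNP.PneNP.Theorems
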